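import Summits.RiemannHypothesis.RiemannHypothesis.Theorems.PfPersistenceEigenvectorTolerance
import HarnessLib

/-!
# PF persistence — the SECOND LEVEL `ε₂` (I): Courant–Fischer attainment at every bottom vector, and
# the gap binder IS the gauge
(pub-rhpf, cand-3 gen 9 — CAND seat 3, variational / second-eigenvalue structure; companion file
`PfPersistenceSecondLevelWalls` carries the Weyl–Lipschitz law, the W2 walls for gap readers, gap persistence and
the nesting in the truncation rank)

**HONEST FRAMING. This is a mechanism/rigidity campaign; no RH claims.** Everything in this file is RH-free,
finite-dimensional VARIATIONAL algebra about real window matrices `M : Matrix (Fin (n+1)) (Fin (n+1)) ℝ` in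
dimension `≥ 2` (`0 < n`), their bottom Rayleigh value `bottomRayleigh` (`ε₁`), the TYPED second level
`secondRayleigh` (`ε₂ := ⨆_u sInf` of the Rayleigh quotients on `u^⊥`, `PfPersistenceGapClassG1` §7 — typed there,
used nowhere in the tree until now) and the bottom-gap GAUGE `bottomGapGauge d win = ε₂ − ε₁` (schema
`eps2_even − eps1_even`). Labels: every statement is PROVED; no DATA enters; nothing here bears on the truth of RH.

* §1 THE RAYLEIGH SET ON AN ORTHOGONAL COMPLEMENT `orthRayleighSet M u` (so `ε₂ = ⨆_u sInf (orthRayleighSet M u)`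
  definitionally): nonempty in dimension `≥ 2` (`exists_ne_zero_dotProduct_eq_zero`), bounded below by `ε₁`, its
  infimum bounded above by the entry sum; hence `ε₁ ≤ ε₂ ≤ Σ|M_{ij}|` with NO symmetry, and the `⨆` is a genuine
  supremum (`bddAbove_range_sInf_orthRayleighSet`), not a junk value.
* §2 **COURANT–FISCHER ATTAINMENT WITHOUT COMPACTNESS OR CALCULUS** (`secondRayleigh_eq_sInf_orthRayleighSet`): for
  a SYMMETRIC matrix and ANY bottom vector `u₀`, `ε₂ = sInf (orthRayleighSet M u₀)` — the `⨆` is attained at every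
  bottom vector. Proof: for an arbitrary `u`, the plane spanned by `u₀` and a near-minimiser `y ⊥ u₀` contains a
  nonzero vector orthogonal to `u`, and on that plane the form is `≤ (sInf + δ)|v|²` because the cross term
  `u₀ᵀMy = ε₁ (u₀·y) = 0` vanishes (symmetry + `Mu₀ = ε₁u₀`). Homogeneous form: `ε₂|v|² ≤ vᵀMv` on `u₀^⊥`.
* §3 **THE GAP BINDER IS THE GAUGE** (`hasBottomGap_iff`, `exists_hasBottomGap_iff`): for symmetric `M`,
  `HasBottomGap M u₀ γ ↔ IsBottomVector M u₀ ∧ 0 < γ ∧ ε₁ + γ ≤ ε₂`, and `(∃ u₀, HasBottomGap M u₀ γ) ↔ 0 < γ ∧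
  ε₁ + γ ≤ ε₂`; on the dial space, `(∃ u₀, HasBottomGap (d win) u₀ γ) ↔ 0 < γ ∧ γ ≤ bottomGapGauge d win`. So the
  per-window NUMERICAL BINDER of the eigenvector walls (`PfPersistenceEigenvectorTolerance`, `…ConeContinuity`;
  RULING A195's 'modulo per-window gap binders') is discharged by the two lowest eigenvalues of ONE symmetric matrix —
  no eigenvector enters — EVERY bottom vector then carries the gap (`HasBottomGap.of_isBottomVector`), and a
  positive gauge at `ζ`'s window is itself the largest gap binder (`zeta_exists_hasBottomGap_of_gauge_pos`).
HONEST RESIDUE (recorded, not targeted): nothing here says the gauge of `ζ`'s window matrix is positive at any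
window (that is per-window DATA, to be certified by the engines), nor anything about gap class G1; dimension-one
windows (`N = 0`) are excluded throughout (`ε₂` is a junk `sInf ∅` value there).
-/


set_option linter.dupNamespace false  -- the mandated namespace repeats `RiemannHypothesis`

noncomputable section

open Matrix Set Filter Topology

open Literature.NumberTheory.LFunctions

namespace Summit.RiemannHypothesis.RiemannHypothesis.Theorems.PfPersistence

/-! ## §1 The Rayleigh set on an orthogonal complement; `ε₁ ≤ ε₂ ≤ Σ|M_{ij}|` -/

/-- the RAYLEIGH SET ON THE ORTHOGONAL COMPLEMENT of `u`: Rayleigh quotients of nonzero vectors `v ⊥ u`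
(`secondRayleigh M = ⨆ u, sInf (orthRayleighSet M u)` definitionally). [folklore] -/
def orthRayleighSet {n : ℕ} (M : Matrix (Fin n) (Fin n) ℝ) (u : Fin n → ℝ) : Set ℝ :=
  {r : ℝ | ∃ v : Fin n → ℝ, v ≠ 0 ∧ v ⬝ᵥ u = 0 ∧ r = v ⬝ᵥ (M *ᵥ v) / (v ⬝ᵥ v)}

/-- PROVED: `ε₂ = ⨆_u sInf (orthRayleighSet M u)` (definitional unfolding of `secondRayleigh`). [folklore] -/
theorem secondRayleigh_eq_iSup {n : ℕ} (M : Matrix (Fin n) (Fin n) ℝ) :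
    secondRayleigh M = ⨆ u : Fin n → ℝ, sInf (orthRayleighSet M u) :=
  rfl

/-- PROVED: the orthogonal Rayleigh set is part of the Rayleigh set. [folklore] -/
theorem orthRayleighSet_subset_rayleighSet {n : ℕ} (M : Matrix (Fin n) (Fin n) ℝ) (u : Fin n → ℝ) :
    orthRayleighSet M u ⊆ rayleighSet M := by
  rintro r ⟨v, hv, -, rfl⟩
  exact ⟨v, hv, rfl⟩

/-- PROVED: the orthogonal Rayleigh set is bounded below. [folklore] -/
theorem orthRayleighSet_bddBelow {n : ℕ} (M : Matrix (Fin n) (Fin n) ℝ) (u : Fin n → ℝ) :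
    BddBelow (orthRayleighSet M u) :=
  (rayleighSet_bddBelow M).mono (orthRayleighSet_subset_rayleighSet M u)

/-- PROVED: every Rayleigh quotient is `≤ Σ|M_{ij}|`. [folklore] -/
theorem rayleigh_le_entrySum {n : ℕ} (M : Matrix (Fin n) (Fin n) ℝ) {v : Fin n → ℝ} (hv : v ≠ 0) :
    v ⬝ᵥ (M *ᵥ v) / (v ⬝ᵥ v) ≤ entrySum M := by
  rw [div_le_iff₀ (dotSelf_pos_of_ne_zero hv)]
  exact (le_abs_self _).trans (abs_form_le_entrySum_mul M v)

/-- **PROVED — in dimension `≥ 2` every vector has a NONZERO ORTHOGONAL vector** (two coordinates suffice).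
[folklore] -/
theorem exists_ne_zero_dotProduct_eq_zero {n : ℕ} (hn : 0 < n) (u : Fin (n + 1) → ℝ) :
    ∃ v : Fin (n + 1) → ℝ, v ≠ 0 ∧ v ⬝ᵥ u = 0 := by
  have h0l : (0 : Fin (n + 1)) ≠ Fin.last n := by
    intro h
    have := congrArg Fin.val h
    simp at this
    omega
  by_cases hu : u 0 = 0
  · refine ⟨Pi.single 0 1, ?_, ?_⟩
    · intro h
      have := congr_fun h 0
      simp at this
    · rw [single_dotProduct, one_mul, hu]
  · refine ⟨u (Fin.last n) • Pi.single 0 1 - u 0 • Pi.single (Fin.last n) 1, ?_, ?_⟩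
    · intro h
      have := congr_fun h (Fin.last n)
      simp [h0l.symm] at this
      exact hu this
    · simp only [sub_dotProduct, smul_dotProduct, single_dotProduct, smul_eq_mul, one_mul]
      ring

/-- PROVED: in dimension `≥ 2` the orthogonal Rayleigh set is nonempty. [folklore] -/
theorem orthRayleighSet_nonempty {n : ℕ} (hn : 0 < n) (M : Matrix (Fin (n + 1)) (Fin (n + 1)) ℝ)
    (u : Fin (n + 1) → ℝ) : (orthRayleighSet M u).Nonempty := by
  obtain ⟨v, hv, hvu⟩ := exists_ne_zero_dotProduct_eq_zero hn u
  exact ⟨_, v, hv, hvu, rfl⟩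

/-- PROVED: `ε₁ ≤ sInf (orthRayleighSet M u)` (dimension `≥ 2`, no symmetry). [folklore] -/
theorem bottomRayleigh_le_sInf_orthRayleighSet {n : ℕ} (hn : 0 < n) (M : Matrix (Fin (n + 1)) (Fin (n + 1)) ℝ)
    (u : Fin (n + 1) → ℝ) : bottomRayleigh M ≤ sInf (orthRayleighSet M u) :=
  le_csInf (orthRayleighSet_nonempty hn M u) (by
    rintro r ⟨v, hv, -, rfl⟩
    exact bottomRayleigh_le_rayleigh M hv)

/-- PROVED: `sInf (orthRayleighSet M u) ≤ Σ|M_{ij}|` (dimension `≥ 2`, no symmetry). [folklore] -/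
theorem sInf_orthRayleighSet_le_entrySum {n : ℕ} (hn : 0 < n) (M : Matrix (Fin (n + 1)) (Fin (n + 1)) ℝ)
    (u : Fin (n + 1) → ℝ) : sInf (orthRayleighSet M u) ≤ entrySum M := by
  obtain ⟨v, hv, hvu⟩ := exists_ne_zero_dotProduct_eq_zero hn u
  exact (csInf_le (orthRayleighSet_bddBelow M u) ⟨v, hv, hvu, rfl⟩).trans (rayleigh_le_entrySum M hv)

/-- PROVED: the family `u ↦ sInf (orthRayleighSet M u)` is bounded above (so the `⨆` in `ε₂` is a genuine
supremum, not a junk value). [folklore] -/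
theorem bddAbove_range_sInf_orthRayleighSet {n : ℕ} (hn : 0 < n) (M : Matrix (Fin (n + 1)) (Fin (n + 1)) ℝ) :
    BddAbove (Set.range fun u : Fin (n + 1) → ℝ => sInf (orthRayleighSet M u)) :=
  ⟨entrySum M, Set.forall_mem_range.2 fun u => sInf_orthRayleighSet_le_entrySum hn M u⟩

/-- PROVED: `sInf (orthRayleighSet M u) ≤ ε₂` for every `u` (dimension `≥ 2`). [folklore] -/
theorem sInf_orthRayleighSet_le_secondRayleigh {n : ℕ} (hn : 0 < n) (M : Matrix (Fin (n + 1)) (Fin (n + 1)) ℝ)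
    (u : Fin (n + 1) → ℝ) : sInf (orthRayleighSet M u) ≤ secondRayleigh M :=
  le_ciSup (bddAbove_range_sInf_orthRayleighSet hn M) u

/-- **PROVED — `ε₁ ≤ ε₂`** (dimension `≥ 2`, no symmetry). [folklore] -/
theorem bottomRayleigh_le_secondRayleigh {n : ℕ} (hn : 0 < n) (M : Matrix (Fin (n + 1)) (Fin (n + 1)) ℝ) :
    bottomRayleigh M ≤ secondRayleigh M :=
  (bottomRayleigh_le_sInf_orthRayleighSet hn M 0).trans (sInf_orthRayleighSet_le_secondRayleigh hn M 0)

/-- PROVED: `ε₂ ≤ Σ|M_{ij}|` (dimension `≥ 2`, no symmetry). [folklore] -/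
theorem secondRayleigh_le_entrySum {n : ℕ} (hn : 0 < n) (M : Matrix (Fin (n + 1)) (Fin (n + 1)) ℝ) :
    secondRayleigh M ≤ entrySum M :=
  ciSup_le fun u => sInf_orthRayleighSet_le_entrySum hn M u

/-- PROVED: the gauge is nonnegative in dimension `≥ 2`: `0 ≤ ε₂ − ε₁`. [folklore] -/
theorem bottomGapGauge_nonneg (d : Datum) (win : Window) (hN : 0 < win.N) : 0 ≤ bottomGapGauge d win :=
  sub_nonneg.2 (bottomRayleigh_le_secondRayleigh hN (d win))

/-! ## §2 Courant–Fischer attainment: the `⨆` in `ε₂` is attained at every bottom vector (symmetric case) -/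

/-- PROVED: the mass of a combination of two ORTHOGONAL vectors. [folklore] -/
theorem dotSelf_add_smul_of_orth {n : ℕ} {x y : Fin n → ℝ} (hxy : y ⬝ᵥ x = 0) (α β : ℝ) :
    (α • x + β • y) ⬝ᵥ (α • x + β • y) = α * α * (x ⬝ᵥ x) + β * β * (y ⬝ᵥ y) := by
  have hxy' : x ⬝ᵥ y = 0 := by rw [dotProduct_comm]; exact hxy
  simp only [add_dotProduct, dotProduct_add, smul_dotProduct, dotProduct_smul, smul_eq_mul, hxy, hxy']
  ring

/-- PROVED: the form of a combination of a BOTTOM VECTOR `x` and a vector `y ⊥ x` (symmetric `M`): the cross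
term vanishes, `(αx+βy)ᵀM(αx+βy) = α² ε₁|x|² + β² yᵀMy`. [folklore] -/
theorem form_add_smul_of_isBottomVector_of_orth {n : ℕ} {M : Matrix (Fin n) (Fin n) ℝ} (hM : M.IsSymm)
    {x y : Fin n → ℝ} (hx : IsBottomVector M x) (hxy : y ⬝ᵥ x = 0) (α β : ℝ) :
    (α • x + β • y) ⬝ᵥ (M *ᵥ (α • x + β • y)) =
      α * α * (bottomRayleigh M * (x ⬝ᵥ x)) + β * β * (y ⬝ᵥ (M *ᵥ y)) := by
  have h1 : y ⬝ᵥ (M *ᵥ x) = 0 := by rw [dotProduct_mulVec_of_isBottomVector hx, hxy, mul_zero]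
  have h2 : x ⬝ᵥ (M *ᵥ y) = 0 := by
    rw [dotProduct_mulVec, ← mulVec_transpose, hM.eq, dotProduct_comm]; exact h1
  have h3 : x ⬝ᵥ (M *ᵥ x) = bottomRayleigh M * (x ⬝ᵥ x) := form_eq_of_isBottomVector hx
  simp only [mulVec_add, mulVec_smul, add_dotProduct, dotProduct_add, smul_dotProduct, dotProduct_smul,
    smul_eq_mul, h1, h2, h3]
  ring

/-- PROVED: in the plane of `x ≠ 0` and any `y` there is a nontrivial combination orthogonal to a given `u`.
[folklore] -/
theorem exists_comb_dotProduct_eq_zero {n : ℕ} (x y u : Fin n → ℝ) :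
    ∃ α β : ℝ, (α ≠ 0 ∨ β ≠ 0) ∧ (α • x + β • y) ⬝ᵥ u = 0 := by
  by_cases h : x ⬝ᵥ u = 0
  · exact ⟨1, 0, Or.inl one_ne_zero, by simp [h]⟩
  · refine ⟨y ⬝ᵥ u, -(x ⬝ᵥ u), Or.inr (neg_ne_zero.2 h), ?_⟩
    simp only [add_dotProduct, smul_dotProduct, smul_eq_mul]
    ring

/-- **PROVED — THE KEY INEQUALITY: at a bottom vector `u₀` of a symmetric matrix the constrained infimum is
MAXIMAL,** `sInf (orthRayleighSet M u) ≤ sInf (orthRayleighSet M u₀)` for every `u` (dimension `≥ 2`). No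
compactness and no calculus: a plane argument. [folklore] -/
theorem sInf_orthRayleighSet_le_of_isBottomVector {n : ℕ} (hn : 0 < n) {M : Matrix (Fin (n + 1)) (Fin (n + 1)) ℝ}
    (hM : M.IsSymm) {u₀ : Fin (n + 1) → ℝ} (hu₀ : IsBottomVector M u₀) (u : Fin (n + 1) → ℝ) :
    sInf (orthRayleighSet M u) ≤ sInf (orthRayleighSet M u₀) := by
  set m := sInf (orthRayleighSet M u₀) with hm_def
  refine le_of_forall_pos_le_add fun δ hδ => ?_
  obtain ⟨r, ⟨y, hy, hyu₀, rfl⟩, hr⟩ :=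
    (csInf_lt_iff (orthRayleighSet_bddBelow M u₀) (orthRayleighSet_nonempty hn M u₀)).1
      (lt_add_of_pos_right m hδ)
  obtain ⟨α, β, hαβ, horth⟩ := exists_comb_dotProduct_eq_zero u₀ y u
  have hyy : 0 < y ⬝ᵥ y := dotSelf_pos_of_ne_zero hy
  have huu : 0 < u₀ ⬝ᵥ u₀ := dotSelf_pos_of_ne_zero hu₀.1
  have hvv_eq := dotSelf_add_smul_of_orth hyu₀ α β
  have hvv : 0 < (α • u₀ + β • y) ⬝ᵥ (α • u₀ + β • y) := by
    rw [hvv_eq]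
    rcases hαβ with hα | hβ
    · have := mul_pos (mul_self_pos.2 hα) huu
      nlinarith [mul_nonneg (mul_self_nonneg β) hyy.le]
    · have := mul_pos (mul_self_pos.2 hβ) hyy
      nlinarith [mul_nonneg (mul_self_nonneg α) huu.le]
  have hv : α • u₀ + β • y ≠ 0 := by
    intro h
    rw [h, zero_dotProduct] at hvv
    exact lt_irrefl _ hvv
  have hform := form_add_smul_of_isBottomVector_of_orth hM hu₀ hyu₀ α β
  have hy' : y ⬝ᵥ (M *ᵥ y) ≤ (m + δ) * (y ⬝ᵥ y) := by
    have := hr.le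
    rwa [div_le_iff₀ hyy] at this
  have h1 : bottomRayleigh M ≤ m + δ := by
    have := bottomRayleigh_le_rayleigh M hy
    linarith
  have hRv : (α • u₀ + β • y) ⬝ᵥ (M *ᵥ (α • u₀ + β • y)) / ((α • u₀ + β • y) ⬝ᵥ (α • u₀ + β • y)) ≤ m + δ := by
    rw [div_le_iff₀ hvv, hform, hvv_eq]
    have hA := mul_le_mul_of_nonneg_left (mul_le_mul_of_nonneg_right h1 huu.le) (mul_self_nonneg α)
    have hB := mul_le_mul_of_nonneg_left hy' (mul_self_nonneg β)
    nlinarith [hA, hB]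
  exact (csInf_le (orthRayleighSet_bddBelow M u) ⟨_, hv, horth, rfl⟩).trans hRv

/-- **PROVED — COURANT–FISCHER ATTAINMENT: `ε₂ = sInf (orthRayleighSet M u₀)` at EVERY bottom vector `u₀` of a
symmetric matrix** (dimension `≥ 2`): the second level is the bottom of the Rayleigh quotient on `u₀^⊥`. [folklore] -/
theorem secondRayleigh_eq_sInf_orthRayleighSet {n : ℕ} (hn : 0 < n) {M : Matrix (Fin (n + 1)) (Fin (n + 1)) ℝ}
    (hM : M.IsSymm) {u₀ : Fin (n + 1) → ℝ} (hu₀ : IsBottomVector M u₀) :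
    secondRayleigh M = sInf (orthRayleighSet M u₀) :=
  le_antisymm (ciSup_le fun u => sInf_orthRayleighSet_le_of_isBottomVector hn hM hu₀ u)
    (sInf_orthRayleighSet_le_secondRayleigh hn M u₀)

/-- PROVED (homogeneous form): at a bottom vector `u₀` of a symmetric matrix, `ε₂ |v|² ≤ vᵀMv` for every
`v ⊥ u₀`. [folklore] -/
theorem secondRayleigh_mul_le_form_of_orth {n : ℕ} (hn : 0 < n) {M : Matrix (Fin (n + 1)) (Fin (n + 1)) ℝ}
    (hM : M.IsSymm) {u₀ : Fin (n + 1) → ℝ} (hu₀ : IsBottomVector M u₀) {v : Fin (n + 1) → ℝ}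
    (hv : v ⬝ᵥ u₀ = 0) : secondRayleigh M * (v ⬝ᵥ v) ≤ v ⬝ᵥ (M *ᵥ v) := by
  by_cases hv0 : v = 0
  · subst hv0; simp
  rw [secondRayleigh_eq_sInf_orthRayleighSet hn hM hu₀, ← le_div_iff₀ (dotSelf_pos_of_ne_zero hv0)]
  exact csInf_le (orthRayleighSet_bddBelow M u₀) ⟨v, hv0, hv, rfl⟩

/-! ## §3 The gap binder IS the gauge -/

/-- **PROVED — `HasBottomGap M u₀ γ ↔ (u₀ bottom vector) ∧ 0 < γ ∧ ε₁ + γ ≤ ε₂`** (symmetric, dimension `≥ 2`):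
the variational gap binder of the eigenvector walls is EXACTLY a lower bound on the gauge `ε₂ − ε₁`. [folklore] -/
theorem hasBottomGap_iff {n : ℕ} (hn : 0 < n) {M : Matrix (Fin (n + 1)) (Fin (n + 1)) ℝ} (hM : M.IsSymm)
    {u₀ : Fin (n + 1) → ℝ} {γ : ℝ} :
    HasBottomGap M u₀ γ ↔ IsBottomVector M u₀ ∧ 0 < γ ∧ bottomRayleigh M + γ ≤ secondRayleigh M := by
  constructor
  · rintro ⟨hu₀, hγ, h⟩
    refine ⟨hu₀, hγ, ?_⟩
    rw [secondRayleigh_eq_sInf_orthRayleighSet hn hM hu₀]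
    refine le_csInf (orthRayleighSet_nonempty hn M u₀) ?_
    rintro r ⟨v, hv, hvu, rfl⟩
    rw [le_div_iff₀ (dotSelf_pos_of_ne_zero hv)]
    exact h v hvu
  · rintro ⟨hu₀, hγ, h⟩
    refine ⟨hu₀, hγ, fun v hvu => ?_⟩
    have := secondRayleigh_mul_le_form_of_orth hn hM hu₀ hvu
    nlinarith [dotProduct_self_nonneg_real v]

/-- **PROVED — a gap EXISTS iff `0 < γ ≤ ε₂ − ε₁`** (symmetric, dimension `≥ 2`; bottom vectors exist by
`exists_isBottomVector_of_isSymm`). [folklore] -/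
theorem exists_hasBottomGap_iff {n : ℕ} (hn : 0 < n) {M : Matrix (Fin (n + 1)) (Fin (n + 1)) ℝ} (hM : M.IsSymm)
    {γ : ℝ} : (∃ u₀, HasBottomGap M u₀ γ) ↔ 0 < γ ∧ bottomRayleigh M + γ ≤ secondRayleigh M := by
  constructor
  · rintro ⟨u₀, h⟩
    exact ((hasBottomGap_iff hn hM).1 h).2
  · rintro ⟨hγ, h⟩
    obtain ⟨u₀, hu₀, -⟩ := exists_isBottomVector_of_isSymm hM
    exact ⟨u₀, (hasBottomGap_iff hn hM).2 ⟨hu₀, hγ, h⟩⟩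

/-- **PROVED — once gapped, EVERY bottom vector carries the gap** (symmetric, dimension `≥ 2`). [folklore] -/
theorem HasBottomGap.of_isBottomVector {n : ℕ} (hn : 0 < n) {M : Matrix (Fin (n + 1)) (Fin (n + 1)) ℝ}
    (hM : M.IsSymm) {u₀ u : Fin (n + 1) → ℝ} {γ : ℝ} (h : HasBottomGap M u₀ γ) (hu : IsBottomVector M u) :
    HasBottomGap M u γ :=
  (hasBottomGap_iff hn hM).2 ⟨hu, ((hasBottomGap_iff hn hM).1 h).2⟩

/-- PROVED: the gap is monotone — any smaller positive `γ'` is also a gap. [folklore] -/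
theorem HasBottomGap.of_le {n : ℕ} {M : Matrix (Fin n) (Fin n) ℝ} {u₀ : Fin n → ℝ} {γ γ' : ℝ}
    (h : HasBottomGap M u₀ γ) (hγ' : 0 < γ') (hle : γ' ≤ γ) : HasBottomGap M u₀ γ' :=
  ⟨h.1, hγ', fun v hv => by nlinarith [h.2.2 v hv, dotProduct_self_nonneg_real v]⟩

/-- **PROVED — ON THE DIAL SPACE THE BINDER IS THE SCHEMA GAUGE:** for `d ∈ dialSpace` and a window of dimension
`≥ 2`, `(∃ u₀, HasBottomGap (d win) u₀ γ) ↔ 0 < γ ∧ γ ≤ bottomGapGauge d win`. [folklore] -/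
theorem exists_hasBottomGap_iff_le_bottomGapGauge {d : Datum} (hd : d ∈ dialSpace) (win : Window)
    (hN : 0 < win.N) {γ : ℝ} : (∃ u₀, HasBottomGap (d win) u₀ γ) ↔ 0 < γ ∧ γ ≤ bottomGapGauge d win := by
  rw [exists_hasBottomGap_iff hN (isSymm_of_mem_dialSpace hd win)]
  simp only [bottomGapGauge]
  constructor <;> rintro ⟨h1, h2⟩ <;> exact ⟨h1, by linarith⟩

/-- PROVED: the same at `ζ`. [folklore] -/
theorem zeta_exists_hasBottomGap_iff (win : Window) (hN : 0 < win.N) {γ : ℝ} :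
    (∃ u₀, HasBottomGap (zetaDatum win) u₀ γ) ↔ 0 < γ ∧ γ ≤ bottomGapGauge zetaDatum win :=
  exists_hasBottomGap_iff_le_bottomGapGauge zetaDatum_mem_dialSpace win hN

/-- PROVED: a positive gauge at `ζ`'s window IS a gap binder with `γ = ε₂ − ε₁` (the largest one). [folklore] -/
theorem zeta_exists_hasBottomGap_of_gauge_pos (win : Window) (hN : 0 < win.N)
    (h : 0 < bottomGapGauge zetaDatum win) : ∃ u₀, HasBottomGap (zetaDatum win) u₀ (bottomGapGauge zetaDatum win) :=
  (zeta_exists_hasBottomGap_iff win hN).2 ⟨h, le_rfl⟩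

end Summit.RiemannHypothesis.RiemannHypothesis.Theorems.PfPersistence

end
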